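import Summits.BirchSwinnertonDyer.BirchSwinnertonDyer.Theorems.CMKolyvaginAtInertTwoRestrictionInjectiveAtTwo
import Summits.BirchSwinnertonDyer.BirchSwinnertonDyer.Theorems.CMKolyvaginAtInertTwoTranspositionAtTwo
import Summits.BirchSwinnertonDyer.Rank1Residual.X11b.RingClassFieldNoTorsion
import Literature.NumberTheory.EllipticCurves.HeegnerPointReflectionProofs
import Literature.NumberTheory.EllipticCurves.SerreOpenImageOrdinaryInertiaProofs
import Literature.NumberTheory.EllipticCurves.ModularityVersionApProofs
import Literature.NumberTheory.QuadraticFields.FundamentalDiscriminant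
import HarnessLib

/-!
# Route `GenusKolyvaginAtTwo`, LINE 6, Q2 `KolyvaginRelationAtTwo` (stmt-BirchSwinnertonDyer-24880):
# GROSS'S LEMMA 4.3 AT `p = 2` and the `hA` binder of McCallum's class at `2` (seat gk2-p2 g7; helper)

Gross 1991, Lemma 4.3 (*"`E` has no `K_n`-rational `p`-torsion"*) is printed and proved in the tree
(x11b3 `RingClassNoTorsion.isAdmissible_pointsSubgroup`) for `p` ODD (*"`GL₂(ℤ/p)` is not a quotient
of a group of dihedral type"*). At `p = 2` it is FALSE as stated (`GL₂(𝔽₂) ≅ S₃` is dihedral; at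
`K = ℚ(√Δ_E)` the `2`-division field lies in a ring class field of `K` — the field that makes Q5 false
as typed). The correct statement: §1 the `4`-group — a `3`-cycle and a transposition in `ρ̄(Γ)` leave
no non-zero vector fixed by a normal subgroup containing the commutators
(`eq_zero_of_forall_smul_eq_of_commutator_two`, replacing the tree's `p ≠ 2` lemma
`eq_zero_of_forall_smul_eq_of_normal`); §2 `E(L)[2] = 0` for `L/F` finite abelian over any number
field once `ρ̄_{V,2}(Γ_F) = S₃`; §3 ring class fields: `ρ̄_{W,2}` onto and `d_K · Δ_W ∉ ℚ²`
(`K ≠ ℚ(√Δ_W)`) ⟹ `E(K[n])[2^M] = 0` and `IsAdmissible Γ_K E(K[n]) 2^M`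
(`isAdmissible_pointsSubgroup_two`; `3`-cycle / transposition from cmk2-p1's `KolyvaginImageTwo`);
§4 the exclusion is AUTOMATIC under the Heegner hypothesis with `d_K ≠ −4` — Q2's binders —
(`not_isSquare_discr_mul_Δ_of_satisfiesHeegnerHypothesis`, `isAdmissible_pointsSubgroup_two_of_heegner`);
so the parent crux's binder `¬ IsSquare (d_K · (−|Δ|))` is redundant given Heegner + `d_K` odd.
HONEST FRAMING: helper theorems only (no definition, no named fact, no `sorry`); nothing here closes Q2;
BSD is not proved by any of this. References: [GrossLMS1991] §4 Lemma 4.3, §1; [McCallumLMS1991] §4 (5);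
[Kolyvagin1989Izv] Thm. B; [DokchitserDokchitserMathZ2012] Thm. 1; [LawsonWuthrich2016] Lemma 6;
[Cox2013] §9.A.
-/

set_option autoImplicit false
set_option linter.dupNamespace false

noncomputable section

open scoped Classical

namespace Summit.BirchSwinnertonDyer.BirchSwinnertonDyer.Theorems.GenusExact

open WeierstrassCurve Field NumberField
open Field.absoluteGaloisGroup (toAlgEquiv)
open Literature.NumberTheory.EllipticCurves Literature.NumberTheory.GaloisRepresentations
open Summit.BirchSwinnertonDyer.BirchSwinnertonDyer.Theorems.KolyvaginImageTwo
open Summit.BirchSwinnertonDyer.Rank1Residual.X11b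

universe u

/-! ### §1 The group theory of Lemma 4.3 at `2`: `S₃` is not "dihedral over an `N`-fixed vector" -/

section GroupTheory

variable {Γ : Type*} [Group Γ] {T : Type*} [AddCommGroup T] [DistribMulAction Γ T]

/-- **The group theory of Gross's Lemma 4.3 at `p = 2`.** `Γ` acts on a `4`-group `T` (printed
`E[2]`) with a `3`-cycle `z` (no non-zero fixed vector) and a transposition `g` (`gu = u ≠ 0`, `gw ≠ w`),
i.e. `ρ̄(Γ) ≅ S₃`; `N ⊴ Γ` is normal and contains every commutator (printed: `N ⊇ Gal(K̄/K_n)`, `K_n/K`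
abelian). Then `T^N = 0`: if `N` fixes `Q ≠ 0` it fixes `zQ ≠ Q`, hence `T = {0, Q, zQ, Q + zQ}`; the
commutator `[z, g] ∈ N` sends `g(zu)` to `zu`, so `g` fixes `u ≠ zu`, hence everything.
[cite: GrossLMS1991, Lemma 4.3 (proof: "not a quotient of a group of dihedral type")] -/
theorem eq_zero_of_forall_smul_eq_of_commutator_two (h2 : ∀ t : T, t + t = 0)
    (hcard : Nat.card T = 4) (N : Subgroup Γ) [N.Normal]
    (hcomm : ∀ a b : Γ, a * b * a⁻¹ * b⁻¹ ∈ N)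
    {z : Γ} (hz : ∀ t : T, z • t = t → t = 0)
    {g : Γ} {u w : T} (hu : u ≠ 0) (hgu : g • u = u) (hgw : g • w ≠ w)
    {Q : T} (hQ : ∀ n ∈ N, n • Q = Q) : Q = 0 := by
  by_contra hQ0
  -- `N` fixes `z • Q`, hence every vector
  have hzQ0 : z • Q ≠ 0 := fun h ↦ hQ0 ((smul_eq_zero_iff_eq z).mp h)
  have hzQQ : z • Q ≠ Q := fun h ↦ hQ0 (hz Q h)
  have hN : ∀ n ∈ N, ∀ t : T, n • t = t := by
    intro n hn t
    have h1 : n • z • Q = z • Q := smul_smul_eq_of_normal hQ z hn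
    rcases mem_four h2 hcard hQ0 hzQ0 hzQQ t with rfl | rfl | rfl | rfl
    · exact smul_zero n
    · exact hQ n hn
    · exact h1
    · rw [smul_add, hQ n hn, h1]
  -- `u' = z • u` is non-zero and different from `u`
  have hu'0 : z • u ≠ 0 := fun h ↦ hu ((smul_eq_zero_iff_eq z).mp h)
  have hu'u : z • u ≠ u := fun h ↦ hu (hz u h)
  -- the commutator `[z, g] ∈ N` maps `g • u'` to `u'`
  have hk : (z * g * z⁻¹ * g⁻¹) • (g • z • u) = z • u := by
    rw [mul_smul, mul_smul, mul_smul, inv_smul_smul, inv_smul_smul, hgu]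
  have hgu' : g • z • u = z • u := by
    have h := hN _ (hcomm z g) (g • z • u)
    rw [hk] at h
    exact h.symm
  -- so `g` fixes `u` and `u'`, hence everything
  have hgall : ∀ t : T, g • t = t := by
    intro t
    rcases mem_four h2 hcard hu hu'0 hu'u t with rfl | rfl | rfl | rfl
    · exact smul_zero g
    · exact hgu
    · exact hgu'
    · rw [smul_add, hgu, hgu']
  exact hgw (hgall w)

end GroupTheory

/-! ### §2 Gross's Lemma 4.3 at `2` for an abelian extension of any number field -/

section Torsion

variable {F : Type} [Field F] [NumberField F] (V : WeierstrassCurve F) [V.IsElliptic]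
  (L : Type) [Field L] [Algebra F L] [IsAbelianGalois F L]

set_option maxHeartbeats 400000 in
/-- **Gross's Lemma 4.3 at `p = 2` for a finite ABELIAN extension `L` of a number field `F`**: if
`Γ_F` has an element acting on `E[2]` without non-zero fixed point and one acting as a transposition
(`ρ̄_{V,2}(Γ_F) = S₃`), then `E(L)[2] = 0` — a point `0 ≠ P ∈ E(L)[2]` gives `0 ≠ Q ∈ E[2]` fixed by the
image of `Γ_L`, which contains `[Γ_F, Γ_F]` (`Gal(L/F)` commutative: the transported commutator
restricts trivially to the normal subextension `L`); then §1. (`DecidableEq L` is quantified, as in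
the odd-`p` twin `RingClassNoTorsion.torsionBy_eq_bot_of_isAbelianGalois`.)
[cite: GrossLMS1991, §4 Lemma 4.3] [cite: LawsonWuthrich2016, Lemma 6 (the element of order 3)] -/
theorem torsionBy_two_eq_bot_of_isAbelianGalois_of_transposition [DecidableEq L]
    {z : absoluteGaloisGroup F} (hz : ∀ P : geomTorsion V ((2 : ℕ) : ℤ), z • P = P → P = 0)
    {g : absoluteGaloisGroup F} {u w : geomTorsion V ((2 : ℕ) : ℤ)} (hu : u ≠ 0) (hgu : g • u = u)
    (hgw : g • w ≠ w) :
    AddSubgroup.torsionBy (V.baseChange L).toAffine.Point ((2 : ℕ) : ℤ) = ⊥ := by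
  obtain rfl : ‹DecidableEq L› = fun a b ↦ Classical.propDecidable (a = b) := Subsingleton.elim _ _
  -- ### every commutator of `Γ_F` is a restriction from `Γ_L` (`Gal(L/F)` is commutative)
  let Φ : absoluteGaloisGroup F ≃* (AlgebraicClosure L ≃ₐ[F] AlgebraicClosure L) :=
    absGaloisTransport (K := F) (L := L)
  let rL : (AlgebraicClosure L ≃ₐ[F] AlgebraicClosure L) →* (L ≃ₐ[F] L) :=
    AlgEquiv.restrictNormalHom L
  have hcommL : ∀ (a b : absoluteGaloisGroup F) (x : L),
      Φ (a * b * a⁻¹ * b⁻¹) (algebraMap L (AlgebraicClosure L) x) =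
        algebraMap L (AlgebraicClosure L) x := by
    intro a b x
    have hr : rL (Φ (a * b * a⁻¹ * b⁻¹)) = 1 := by
      have hc : rL (Φ a) * rL (Φ b) = rL (Φ b) * rL (Φ a) := IsMulCommutative.is_comm.comm _ _
      simp only [map_mul, map_inv]
      rw [hc, mul_inv_cancel_right, mul_inv_cancel]
    have h2 := AlgEquiv.restrictNormal_commutes (Φ (a * b * a⁻¹ * b⁻¹)) L x
    change algebraMap L (AlgebraicClosure L) (rL (Φ (a * b * a⁻¹ * b⁻¹)) x) = _ at h2
    rw [hr, AlgEquiv.one_apply] at h2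
    exact h2.symm
  have hres : ∀ a b : absoluteGaloisGroup F, ∃ τ : absoluteGaloisGroup L,
      resGal (K := F) L τ = a * b * a⁻¹ * b⁻¹ := fun a b ↦ by
    obtain ⟨τ, hτ⟩ :=
      (mem_range_absGaloisRestrict_iff (K := F) (L := L) (a * b * a⁻¹ * b⁻¹)).mpr (hcommL a b)
    exact ⟨τ, hτ⟩
  -- ### a non-zero `L`-rational `2`-torsion point and its preimage `Q ∈ E[2]`
  rw [eq_bot_iff]
  intro P hP
  rw [AddSubgroup.mem_bot]
  by_contra hP0
  have hPp : 2 • P = 0 := AddSubgroup.torsionBy.nsmul_iff.mp hP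
  let f : L →ₐ[F] AlgebraicClosure L := IsScalarTower.toAlgHom F L (AlgebraicClosure L)
  let φ : (V.baseChange L).toAffine.Point →+ localPoints V L := WeierstrassCurve.Affine.Point.map f
  have hφ : Function.Injective φ := WeierstrassCurve.Affine.Point.map_injective _
  obtain ⟨Q, hQ⟩ := (pointsMapOfEmb_bijective L V (closureEmb (K := F) L)).2 (φ P)
  have hQ' : pointsMap V L Q = φ P := hQ
  have hinj : Function.Injective (pointsMap V L) :=
    (pointsMapOfEmb_bijective L V (closureEmb (K := F) L)).1
  have hQ0 : Q ≠ 0 := by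
    rintro rfl
    apply hP0
    apply hφ
    rw [map_zero, ← hQ', map_zero]
  have hQp : 2 • Q = 0 := by
    apply hinj
    rw [map_nsmul, map_zero, hQ', ← map_nsmul, hPp, map_zero]
  -- `Q` is fixed by the image of `Γ_L`
  have hfixL : ∀ τ : absoluteGaloisGroup L, resGal (K := F) L τ • Q = Q := by
    intro τ
    apply hinj
    rw [pointsMap_smul, hQ']
    change WeierstrassCurve.Affine.Point.map
        ((AlgEquiv.restrictScalars F (toAlgEquiv L τ) :
            AlgebraicClosure L ≃ₐ[F] AlgebraicClosure L) :
          AlgebraicClosure L →ₐ[F] AlgebraicClosure L)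
        (WeierstrassCurve.Affine.Point.map f P) =
      WeierstrassCurve.Affine.Point.map f P
    have hgf : ((AlgEquiv.restrictScalars F (toAlgEquiv L τ) :
            AlgebraicClosure L ≃ₐ[F] AlgebraicClosure L) :
          AlgebraicClosure L →ₐ[F] AlgebraicClosure L).comp f = f := by
      ext x
      exact (toAlgEquiv L τ).commutes x
    rw [WeierstrassCurve.Affine.Point.map_map, hgf]
  -- ### the group theory in `E[2]`
  let Mp := ↥(geomTorsion V ((2 : ℕ) : ℤ))
  have hcardM : Nat.card Mp = 4 := by
    have h : Nat.card Mp = 2 ^ 2 :=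
      WeierstrassCurve.card_torsionPoints_eq_sq_holds V (AlgebraicClosure F) (n := 2) (by norm_num)
    rw [h]; norm_num
  have h2M : ∀ t : Mp, t + t = 0 := fun t ↦ by
    have := AddSubgroup.torsionBy.nsmul t
    rwa [two_nsmul] at this
  let Qm : Mp := ⟨Q, AddSubgroup.torsionBy.nsmul_iff.mpr hQp⟩
  have hQm0 : Qm ≠ 0 := fun h ↦ hQ0 (congrArg Subtype.val h)
  -- `N = [Γ_F, Γ_F]` fixes `Qm`
  have hle : commutator (absoluteGaloisGroup F) ≤ MulAction.stabilizer (absoluteGaloisGroup F) Qm := by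
    rw [commutator_def, Subgroup.commutator_le]
    intro a _ b _
    rw [MulAction.mem_stabilizer_iff, commutatorElement_def]
    obtain ⟨τ, hτ⟩ := hres a b
    rw [← hτ]
    exact Subtype.ext (hfixL τ)
  have hQmN : ∀ n ∈ commutator (absoluteGaloisGroup F), n • Qm = Qm := fun n hn ↦ hle hn
  have hcommN : ∀ a b : absoluteGaloisGroup F, a * b * a⁻¹ * b⁻¹ ∈ commutator (absoluteGaloisGroup F) :=
    fun a b ↦ by
      rw [commutator_def, ← commutatorElement_def]
      exact Subgroup.commutator_mem_commutator (Subgroup.mem_top a) (Subgroup.mem_top b)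
  exact hQm0 (eq_zero_of_forall_smul_eq_of_commutator_two h2M hcardM
    (commutator (absoluteGaloisGroup F)) hcommN hz hu hgu hgw hQmN)

end Torsion

/-! ### §3 Ring class fields: `E(K[n])[2^M] = 0` -/

section RingClass

variable (W : WeierstrassCurve ℚ) [W.IsElliptic] {K : Type} [Field K] [NumberField K]

/-- **`Δ_W ∉ K²` for a quadratic `K`** when `Δ_W ∉ ℚ²` (`ρ̄_{W,2}` onto: the `2`-division cubic has
Galois group `S₃`, Dokchitser–Dokchitser) and `d_K · Δ_W ∉ ℚ²` (`K ≠ ℚ(√Δ_W)`): a rational square in `K`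
lies in `ℚ² ∪ d_K ℚ²` (`KolyvaginImageTwo.isSquare_or_isSquare_mul_of_isSquare_algebraMap`).
[cite: DokchitserDokchitserMathZ2012, Thm. 1 (ℚ(E[2]) ⊇ ℚ(√Δ))] -/
theorem not_isSquare_baseChange_Δ (hK2 : Module.finrank ℚ K = 2)
    (hρ : W.HasSurjectiveModNGaloisRep 2) (hsq : ¬ IsSquare ((NumberField.discr K : ℚ) * W.Δ)) :
    ¬ IsSquare (W.baseChange K).Δ := by
  have hΔ : ¬ IsSquare W.Δ :=
    DokchitserDokchitser2012.not_isSquare_Δ_of_hasSurjectiveModNGaloisRep_two W two_ne_zero hρ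
  have e : (W.baseChange K).Δ = algebraMap ℚ K W.Δ := by rw [baseChange, map_Δ]
  rw [e]
  intro h
  rcases isSquare_or_isSquare_mul_of_isSquare_algebraMap K hK2 h with h1 | h1
  · exact hΔ h1
  · exact hsq h1

/-- **Gross's Lemma 4.3 at `p = 2` AT THE RING CLASS FIELD: `E(K[n])[2] = 0`** for `W/ℚ` with
`ρ̄_{W,2}` onto, `K` imaginary quadratic with `d_K · Δ_W ∉ ℚ²` (`K ≠ ℚ(√Δ_W)`, necessary), `n ≠ 0`:
`3`-cycle from cmk2-p1's `exists_smul_three_of_hasSurjectiveModNGaloisRep`, transposition from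
`Δ_W ∉ K²`, `K[n]/K` abelian (`isAbelianGalois_ringClassField`, Cox §9.A).
[cite: GrossLMS1991, §4 Lemma 4.3] [cite: Kolyvagin1989Izv, Thm. B (K ≠ ℚ(√−|Δ|))] [cite: Cox2013, §9.A] -/
theorem torsionBy_two_ringClassField_eq_bot (hK : IsImaginaryQuadratic K) (ι : K →+* ℂ) {n : ℕ}
    (hn : n ≠ 0) (hρ : W.HasSurjectiveModNGaloisRep 2)
    (hsq : ¬ IsSquare ((NumberField.discr K : ℚ) * W.Δ)) :
    AddSubgroup.torsionBy (W.baseChange (ringClassField K ι n)).toAffine.Point ((2 : ℕ) : ℤ) = ⊥ := by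
  haveI := (finiteDimensional_and_isGalois_ringClassField hK ι hn).1
  haveI := (finiteDimensional_and_isGalois_ringClassField hK ι hn).2
  haveI := isAbelianGalois_ringClassField hK ι hn
  haveI : (W.baseChange K).IsElliptic := by rw [baseChange]; infer_instance
  obtain ⟨z, -, hz⟩ := exists_smul_three_of_hasSurjectiveModNGaloisRep W K hK.1 hρ
  obtain ⟨g, u, w, hu, hgu, hgw⟩ :=
    exists_transposition_of_not_isSquare_Δ (W.baseChange K) (not_isSquare_baseChange_Δ W hK.1 hρ hsq)
  have h := torsionBy_two_eq_bot_of_isAbelianGalois_of_transposition (W.baseChange K)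
    (ringClassField K ι n) hz hu hgu hgw
  have hbc : (W.baseChange K).baseChange (ringClassField K ι n) = W.baseChange (ringClassField K ι n) :=
    W.map_baseChange (IsScalarTower.toAlgHom ℚ K (ringClassField K ι n))
  rwa [hbc] at h

/-- **`E(K[n])[2^M] = 0`** under the same hypotheses (McCallum 1991, §4 (5) at `p = 2`: no
`K_n`-rational `2`-torsion ⇒ no `2^M`-torsion, tree `torsionBy_pow_eq_bot`).
[cite: McCallumLMS1991, §4 (5)] [cite: GrossLMS1991, §4 Lemma 4.3] -/
theorem torsionBy_two_pow_ringClassField_eq_bot (hK : IsImaginaryQuadratic K) (ι : K →+* ℂ) {n : ℕ}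
    (hn : n ≠ 0) (hρ : W.HasSurjectiveModNGaloisRep 2)
    (hsq : ¬ IsSquare ((NumberField.discr K : ℚ) * W.Δ)) (M : ℕ) :
    AddSubgroup.torsionBy (W.baseChange (ringClassField K ι n)).toAffine.Point ((2 ^ M : ℕ) : ℤ) = ⊥ :=
  torsionBy_pow_eq_bot (p := 2) (torsionBy_two_ringClassField_eq_bot W hK ι hn hρ hsq) M

end RingClass

/-! ### §4 Under the Heegner hypothesis with `d_K ≠ −4`, `K ≠ ℚ(√Δ_E)` automatically -/

section Heegner

variable (W : WeierstrassCurve ℚ) [W.IsElliptic] [W.IsGloballyMinimal] {K : Type} [Field K] [NumberField K]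

/-- **`d_K · Δ_W ∉ ℚ²` from the Heegner hypothesis and `d_K ≠ −4`** (`W/ℚ` globally minimal, `K`
imaginary quadratic, every prime of `N_W` split): a prime `q ∣ d_K` has `q ∤ N_W`
(`not_dvd_discr_of_satisfiesHeegnerHypothesis`), so good reduction and `q ∤ Δ_min`; thus
`gcd(d_K, Δ_min) = 1`, `d_K Δ_min = □` forces `d_K = −a²` (`Int.sq_of_isCoprime`, `d_K < 0`), and a
fundamental discriminant of this shape is `−4` (`isFundamentalDiscriminant_discr`). So Kolyvagin's
exclusion `K ≠ ℚ(√Δ_E)` (Thm. B; the binder `¬ IsSquare (d_K · (−|Δ|))` of crux 22137 on `Δ < 0`) is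
free on Heegner fields with `d_K ≠ −4`, and Q2's binders exclude the one field where Lemma 4.3 fails.
[cite: GrossLMS1991, §1 (p. 235: all prime factors of N split; D ≠ 3, 4)] [cite: Kolyvagin1989Izv, Thm. B] -/
theorem not_isSquare_discr_mul_Δ_of_satisfiesHeegnerHypothesis (hK : IsImaginaryQuadratic K)
    (hH : SatisfiesHeegnerHypothesis (W.conductorNorm ℤ) K) (hD4 : NumberField.discr K ≠ -4) :
    ¬ IsSquare ((NumberField.discr K : ℚ) * W.Δ) := by
  set d : ℤ := NumberField.discr K with hd
  set D : ℤ := minimalDiscriminantInt W with hD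
  have hDΔ : (D : ℚ) = W.Δ := cast_minimalDiscriminantInt W
  -- `gcd(d_K, Δ_min) = 1`
  have hcop : IsCoprime d D := by
    rw [Int.isCoprime_iff_gcd_eq_one, Int.gcd_eq_natAbs]
    refine Nat.Coprime.gcd_eq_one (Nat.coprime_of_dvd fun q hq hqd hqD ↦ ?_)
    haveI : Fact q.Prime := ⟨hq⟩
    have hqd' : (q : ℤ) ∣ d := Int.ofNat_dvd_left.mpr hqd
    have hqD' : (q : ℤ) ∣ D := Int.ofNat_dvd_left.mpr hqD
    have hbad : ¬ W.HasGoodReductionAtPrime q := fun hgood ↦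
      not_dvd_minimalDiscriminantInt_of_hasGoodReductionAtPrime' W q hgood hqD'
    have hqN : q ∣ W.conductorNorm ℤ :=
      (dvd_conductorNorm_iff_not_hasGoodReductionAtPrime (W := W) q).mpr hbad
    exact not_dvd_discr_of_satisfiesHeegnerHypothesis hK hH hq hqN hqd'
  -- `d_K · Δ_min` is an integer square
  intro hsq
  have hsqZ : IsSquare (d * D) := by
    rw [← Rat.isSquare_intCast_iff]
    push_cast
    rw [hDΔ]
    exact hsq
  obtain ⟨m, hm⟩ := hsqZ
  have hm2 : d * D = m ^ 2 := by rw [sq]; exact hm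
  obtain ⟨a, ha⟩ := Int.sq_of_isCoprime hcop hm2
  have hdneg : d < 0 := hK.discr_neg
  have hda : d = -a ^ 2 := by
    rcases ha with ha | ha
    · exfalso; nlinarith [sq_nonneg a]
    · exact ha
  -- a fundamental discriminant `-a²` is `-4`
  rcases Literature.NumberTheory.QuadraticFields.Quadratic.isFundamentalDiscriminant_discr (K := K) hK.1
    with ⟨h1, hsf, -⟩ | ⟨h4, hmod, hsf⟩
  · -- `d` squarefree: `a` is a unit, `d = -1 ≢ 1 (mod 4)`
    have hsf' : Squarefree d := hsf
    have hunit : IsUnit a := hsf' a ⟨-1, by rw [hda]; ring⟩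
    have hd1 : d = -1 := by
      rcases Int.isUnit_iff.mp hunit with rfl | rfl <;> simpa using hda
    have h1' : d % 4 = 1 := h1
    omega
  · -- `d = 4 m'` with `m'` squarefree: `a = 2b`, `m' = -b²`, `b` a unit, `d = -4`
    have h2a : (2 : ℤ) ∣ a := by
      have h4' : (4 : ℤ) ∣ d := h4
      have h2sq : (2 : ℤ) ∣ a ^ 2 := by
        have : (2 : ℤ) ∣ -a ^ 2 := by rw [← hda]; exact (dvd_trans ⟨2, by norm_num⟩ h4')
        exact (dvd_neg).mp this
      exact Int.prime_two.dvd_of_dvd_pow h2sq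
    obtain ⟨b, hb⟩ := h2a
    have hd4b : d / 4 = -b ^ 2 := by
      have : d = 4 * (-b ^ 2) := by rw [hda, hb]; ring
      rw [this, Int.mul_ediv_cancel_left _ (by norm_num : (4 : ℤ) ≠ 0)]
    have hsf' : Squarefree (d / 4) := hsf
    rw [hd4b] at hsf'
    have hunit : IsUnit b := hsf' b ⟨-1, by ring⟩
    have hdm4 : d = -4 := by
      have hb1 : b ^ 2 = 1 := by
        rcases Int.isUnit_iff.mp hunit with rfl | rfl <;> norm_num
      rw [hda, hb, mul_pow, hb1]; norm_num
    exact hD4 hdm4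

end Heegner

section Admissible

open Literature.NumberTheory.EllipticCurves.ModularForms

variable {K : Type} [Field K] [NumberField K] {N : ℕ} [NeZero N] {W : WeierstrassCurve ℚ}
  {Dt : ModularParametrizationData W N} {β : ℤ} {ι : K →+* ℂ} {n : ℕ}

/-- **The `hA` binder of McCallum's class AT `p = 2`**: `E(K[n]) ⊆ E(K̄)` (`d.pointsSubgroup`) is
`Γ_K`-stable (x11b3's `RingClassNoTorsion.smul_toGeomPoints_eq`) and `2^M`-torsion-free, for every
concrete Kolyvagin–Heegner datum `d` at level `n ≠ 0`, `ρ̄_{W,2}` onto, `d_K · Δ_W ∉ ℚ²` — the `p = 2`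
twin of `RingClassNoTorsion.isAdmissible_pointsSubgroup` (`p ≠ 2`).
[cite: McCallumLMS1991, §4 (5)] [cite: GrossLMS1991, §4 Lemma 4.3 and (4.2)] -/
theorem isAdmissible_pointsSubgroup_two [W.IsElliptic] (d : KolyvaginHeegnerData Dt β ι n)
    (hK : IsImaginaryQuadratic K) (hn : n ≠ 0) (hρ : W.HasSurjectiveModNGaloisRep 2)
    (hsq : ¬ IsSquare ((NumberField.discr K : ℚ) * W.Δ)) (M : ℕ) :
    KolyvaginCocycle.IsAdmissible (absoluteGaloisGroup K) d.pointsSubgroup ((2 ^ M : ℕ) : ℤ) where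
  smul_mem g := by
    rintro _ ⟨P, rfl⟩
    exact ⟨_, (RingClassNoTorsion.smul_toGeomPoints_eq d hK hn g P).symm⟩
  eq_zero_of_zsmul := by
    rintro _ ⟨P, rfl⟩ hP
    rw [← map_zsmul] at hP
    have hP0 : ((2 ^ M : ℕ) : ℤ) • P = 0 :=
      (Affine.Point.map_injective (W' := W) d.emb.toRatAlgHom) (by rw [map_zero]; exact hP)
    have hmem : P ∈ AddSubgroup.torsionBy (W.baseChange (ringClassField K ι n)).toAffine.Point
        ((2 ^ M : ℕ) : ℤ) := (Submodule.mem_torsionBy_iff _ P).mpr hP0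
    rw [torsionBy_two_pow_ringClassField_eq_bot W hK ι hn hρ hsq M, AddSubgroup.mem_bot] at hmem
    rw [hmem, map_zero]

/-- **The `hA` binder at `2` under Q2's own binders**: `W/ℚ` globally minimal with `ρ_{W,2^k}` onto
for all `k` (only `k = 1` used), `K` imaginary quadratic, `d_K ≠ −4`, Heegner hypothesis for `N_W`,
any concrete Kolyvagin–Heegner datum `d` at a level `n ≠ 0`: `E(K[n]) ⊆ E(K̄)` is admissible for
`2^M` — the standing input `hA` of `KolyvaginHeegnerData.kolyvaginClass` at `p = 2` with NO hypothesis
beyond those of `KolyvaginRelationAtTwo` (stmt 24880). [cite: McCallumLMS1991, §4 (5)] [cite: GrossLMS1991, §4 Lemma 4.3, §1] -/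
theorem isAdmissible_pointsSubgroup_two_of_heegner [W.IsElliptic] [W.IsGloballyMinimal]
    (d : KolyvaginHeegnerData Dt β ι n) (hK : IsImaginaryQuadratic K) (hn : n ≠ 0)
    (hD4 : NumberField.discr K ≠ -4) (hH : SatisfiesHeegnerHypothesis (W.conductorNorm ℤ) K)
    (hρ : ∀ k : ℕ, W.HasSurjectiveModNGaloisRep (2 ^ k : ℕ)) (M : ℕ) :
    KolyvaginCocycle.IsAdmissible (absoluteGaloisGroup K) d.pointsSubgroup ((2 ^ M : ℕ) : ℤ) :=
  isAdmissible_pointsSubgroup_two d hK hn (by simpa using hρ 1)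
    (not_isSquare_discr_mul_Δ_of_satisfiesHeegnerHypothesis W hK hH hD4) M

end Admissible

end Summit.BirchSwinnertonDyer.BirchSwinnertonDyer.Theorems.GenusExact

end
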